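import Mathlib
import Literature.Analysis.FluidPDE.SuitableWeak
import Literature.Analysis.FluidPDE.NSSerrinRegularityProofs
import Summits.NavierStokesRegularity.NavierStokesRegularity.Theorems.StretchingWellBindingEnstrophyQuarterLawSparsenessTools
import Summits.NavierStokesRegularity.NavierStokesRegularity.Theses.TypeILiouville
import HarnessLib

/-!
# Shelf crux `EnstrophyQuarterLaw` (stmt-NavierStokesRegularity-1574), line «sparse_sieve»:
# the TYPE-I ENERGY CEILING on swarm size — under sup-rate Type I (stub 6) an S2 family at time `t`
# has at most `C_E / (ε₀³ √(T − t))` members, at EVERY scale `r`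

Helper file (`--supports stmt-NavierStokesRegularity-1574`) for the OPEN registered stub `stub_uniformSparseness`
(S2) of `Cruxes/EnstrophyQuarterLaw/Lines/sparse_sieve.lean`, read together with stub 6 `stub_noTypeII`
(= `TypeILiouville.TypeIliouvilleNoTypeII`, stmt-0056: every first blow-up is `IsTypeIBlowup`). Sequel to
`…EnstrophyQuarterLawTypeICore` (p818328: under Type I no `ε₀`-ball below the parabolic scale `c₁ε₀√(T−t)`) and
`…EnstrophyQuarterLawEnstrophyScaleCount` (p817935: unconditionally `card ≤ C₀ (r·Z(t))³/ε₀⁶`).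

* `card_mul_le_of_norm_le` (static) — a field `v` with `|v| ≤ U` everywhere: every `4r`-separated finite family of
  centres whose balls `B(x,2r)` carry `∫ |v|³ ≥ ε₀³` satisfies `card · ε₀³ ≤ 8 U ∫ |v|²`
  (`|v|³ ≤ U |v|²` pointwise, the balls overlap `≤ 8`-fold by `SparsenessTools.sum_setLIntegral_ball_le_of_separated`);
* `card_le_of_norm_le` — the same in real numbers: `card ≤ 8 U E / ε₀³` whenever `∫ |v|² ≤ E`;
* `card_le_typeI_energy_ceiling` — along a Leray–Hopf solution on `[0,T]` with `IsTypeIBlowup u T`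
  (`|u(t,x)| ≤ C/√(T−t)` for `t₁ < t < T`): for every `ε₀ > 0`, `t ∈ [0,T)` with `t > t₁`, `r > 0` and every S2 family
  `F` at `(t, r)`: `card F ≤ C_E / (ε₀³ √(T−t))` with `C_E = 16 · max C 0 · E(u₀)`, `E(u₀) = ½∫|u₀|²`
  (the energy inequality `∫|u(t)|² ≤ 2E(u₀)`, `IsLerayHopfOn.eEnergy_le_datum`) — uniformly in the SCALE `r`;
* `lifespan_le_of_swarm` — contrapositive reading: a swarm of `N ≥ 1` such balls at time `t` forces
  `T − t ≤ (C_E/(ε₀³ N))²` (large swarms live only in the final window);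
* `typeIEnergyCeiling_of_stub_noTypeII` — under stub 6 this holds at EVERY first blow-up (by name).

READING (census currency, shelf 1574). The registered S2 asks for a bound `N₀(ε₀)` uniform in `(t, r)`. On the Type-I
shelf the two energy-class counts are: this file's `C_E (T−t)^{-1/2}/ε₀³` (energy + sup bound, scale-free) and the
enstrophy count `C₀ (rZ(t))³/ε₀⁶` (p817935). Neither is `O(1)` in the coarse window `c₁ε₀√(T−t) ≤ r ≤ r₁`, and the
`L⁴`-Hölder variant of the first (`∫_B|v|² ≥ ε₀⁶/(U⁴|B|)`) is never better than it (ratio `ε₀³/(U³|B|) ≤ 1` on a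
concentrating ball): the Type-I shelf misses S2 by exactly the Leray amplitude `(T−t)^{-1/2}`, which is why the open
content of the line is the Type-I quarter law K1 ⟨stmt-23726⟩ (census: `EQL ⟺ 0056 ∧ PCORE∀`, p818476).
HONEST FRAMING: elementary bookkeeping along a HYPOTHETICAL Type-I blow-up; S2, stub 6 (0056), the crux
`EnstrophyQuarterLaw` (1574) and Navier–Stokes regularity stay OPEN; no summit statement is proved.
-/

noncomputable section

-- the summit and its single sub-problem share the name (CONVENTIONS §1), as in every Theorems file
set_option linter.dupNamespace false

namespace Summit.NavierStokesRegularity.NavierStokesRegularity.Theorems.EnstrophyQuarterLaw.TypeIEnergyCeiling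

open MeasureTheory Set Metric Filter Topology Module
open Literature.Analysis Literature.Analysis.FluidPDE
open scoped ENNReal NNReal

/-! ### Static pieces: a bounded field -/

/-- **`card · ε₀³ ≤ 8 U ∫ |v|²` for S2 families of a bounded field.** If `‖v y‖ ≤ U` for all `y` and `F` is a
finite family of `4r`-separated centres whose balls `B(x, 2r)` each carry `∫ ‖v‖³ ≥ ε₀³`, then
`card F · ε₀³ ≤ 8 · U · ∫ ‖v‖²` (in `[0,∞]`): pointwise `‖v‖³ ≤ U‖v‖²`, and the balls `B(x,2r)` overlap at most
`8`-fold (`SparsenessTools.sum_setLIntegral_ball_le_of_separated`). [folklore] -/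
theorem card_mul_le_of_norm_le {v : EuclideanSpace ℝ (Fin 3) → EuclideanSpace ℝ (Fin 3)}
    (hv : AEStronglyMeasurable v volume) {U : ℝ} (hbd : ∀ y, ‖v y‖ ≤ U) {r ε₀ : ℝ} (hr : 0 < r)
    (F : Finset (EuclideanSpace ℝ (Fin 3)))
    (hsep : ∀ x ∈ F, ∀ y ∈ F, x ≠ y → 4 * r ≤ dist x y)
    (hconc : ∀ x ∈ F, ENNReal.ofReal (ε₀ ^ 3) ≤ ∫⁻ y in ball x (2 * r), ‖v y‖ₑ ^ 3) :
    (F.card : ℝ≥0∞) * ENNReal.ofReal (ε₀ ^ 3) ≤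
      ENNReal.ofReal 8 * ENNReal.ofReal U * ∫⁻ y, ‖v y‖ₑ ^ 2 := by
  -- pointwise `‖v‖³ ≤ U ‖v‖²`
  have hpt : ∀ y, ‖v y‖ₑ ^ 3 ≤ ENNReal.ofReal U * ‖v y‖ₑ ^ 2 := fun y => by
    rw [pow_succ', ← ofReal_norm]
    exact mul_le_mul' (ENNReal.ofReal_le_ofReal (hbd y)) le_rfl
  have hg : AEMeasurable (fun y => ‖v y‖ₑ ^ 2) volume := hv.enorm.pow_const 2
  -- each ball
  have hball : ∀ x ∈ F, ENNReal.ofReal (ε₀ ^ 3) ≤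
      ENNReal.ofReal U * ∫⁻ y in ball x (2 * r), ‖v y‖ₑ ^ 2 := by
    intro x hx
    refine (hconc x hx).trans ?_
    calc ∫⁻ y in ball x (2 * r), ‖v y‖ₑ ^ 3
        ≤ ∫⁻ y in ball x (2 * r), ENNReal.ofReal U * ‖v y‖ₑ ^ 2 := lintegral_mono fun y => hpt y
      _ = ENNReal.ofReal U * ∫⁻ y in ball x (2 * r), ‖v y‖ₑ ^ 2 :=
          lintegral_const_mul'' _ hg.restrict
  -- bounded overlap of the balls `B(x, 2r)` for `4r`-separated centres
  have hover := SparsenessTools.sum_setLIntegral_ball_le_of_separated (s := 4 * r) (ρ := 2 * r)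
    (by positivity) (by positivity) F hsep hg
  have h8 : ENNReal.ofReal (((2 * r + 4 * r / 2) / (4 * r / 2)) ^ 3) = ENNReal.ofReal 8 := by
    congr 1; field_simp; norm_num
  rw [h8] at hover
  calc (F.card : ℝ≥0∞) * ENNReal.ofReal (ε₀ ^ 3) = ∑ x ∈ F, ENNReal.ofReal (ε₀ ^ 3) := by
        rw [Finset.sum_const, nsmul_eq_mul]
    _ ≤ ∑ x ∈ F, ENNReal.ofReal U * ∫⁻ y in ball x (2 * r), ‖v y‖ₑ ^ 2 := Finset.sum_le_sum hball
    _ = ENNReal.ofReal U * ∑ x ∈ F, ∫⁻ y in ball x (2 * r), ‖v y‖ₑ ^ 2 := by rw [Finset.mul_sum]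
    _ ≤ ENNReal.ofReal U * (ENNReal.ofReal 8 * ∫⁻ y, ‖v y‖ₑ ^ 2) := mul_le_mul' le_rfl hover
    _ = ENNReal.ofReal 8 * ENNReal.ofReal U * ∫⁻ y, ‖v y‖ₑ ^ 2 := by ring

/-- **Real form: `card ≤ 8 U E / ε₀³`.** As in `card_mul_le_of_norm_le`, with `0 ≤ U`, `0 < ε₀` and an energy bound
`∫ ‖v‖² ≤ E` (`0 ≤ E`). [folklore] -/
theorem card_le_of_norm_le {v : EuclideanSpace ℝ (Fin 3) → EuclideanSpace ℝ (Fin 3)}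
    (hv : AEStronglyMeasurable v volume) {U : ℝ} (hU : 0 ≤ U) (hbd : ∀ y, ‖v y‖ ≤ U) {E : ℝ} (hE : 0 ≤ E)
    (hEn : ∫⁻ y, ‖v y‖ₑ ^ 2 ≤ ENNReal.ofReal E) {r ε₀ : ℝ} (hr : 0 < r) (hε₀ : 0 < ε₀)
    (F : Finset (EuclideanSpace ℝ (Fin 3)))
    (hsep : ∀ x ∈ F, ∀ y ∈ F, x ≠ y → 4 * r ≤ dist x y)
    (hconc : ∀ x ∈ F, ENNReal.ofReal (ε₀ ^ 3) ≤ ∫⁻ y in ball x (2 * r), ‖v y‖ₑ ^ 3) :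
    (F.card : ℝ) ≤ 8 * U * E / ε₀ ^ 3 := by
  have h := (card_mul_le_of_norm_le hv hbd hr F hsep hconc).trans (mul_le_mul' le_rfl hEn)
  rw [← ENNReal.ofReal_mul (by norm_num), ← ENNReal.ofReal_mul (by positivity), ← ENNReal.ofReal_natCast,
    ← ENNReal.ofReal_mul (Nat.cast_nonneg _), ENNReal.ofReal_le_ofReal_iff (by positivity)] at h
  rw [le_div_iff₀ (by positivity)]
  exact h

/-! ### The Type-I energy ceiling along a solution -/

/-- **THE TYPE-I ENERGY CEILING on swarm size.** Let `u` be Leray–Hopf on `[0,T]` from `u 0` (energy inequality)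
with `IsTypeIBlowup u T` (`‖u(t,x)‖ ≤ C/√(T−t)` for `t` in a left neighbourhood `(t₁, T)` of `T`). Then there are
`C_E ≥ 0` and `t₁ < T` such that for every `ε₀ > 0`, every `t ∈ [0,T)` with `t₁ < t`, every `r > 0` and every finite
family `F` of `4r`-separated centres whose balls `B(x,2r)` each carry `∫ |u(t)|³ ≥ ε₀³` (the families counted by the
registered stub S2): `card F ≤ C_E / (ε₀³ √(T−t))` (`C_E = 16 · max C 0 · E(u₀)`). Uniform in the scale `r`; uses only
the energy inequality and the sup bound. [folklore] -/
theorem card_le_typeI_energy_ceiling {ν T : ℝ}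
    {u : ℝ → EuclideanSpace ℝ (Fin 3) → EuclideanSpace ℝ (Fin 3)} (hν : 0 < ν)
    (hLH : IsLerayHopfOn T ν 0 (u 0) u) (hI : IsTypeIBlowup u T) :
    ∃ C_E t₁ : ℝ, 0 ≤ C_E ∧ t₁ < T ∧ ∀ ε₀ : ℝ, 0 < ε₀ → ∀ t ∈ Ico 0 T, t₁ < t → ∀ r : ℝ, 0 < r →
      ∀ F : Finset (EuclideanSpace ℝ (Fin 3)),
        (∀ x ∈ F, ∀ y ∈ F, x ≠ y → 4 * r ≤ dist x y) →
        (∀ x ∈ F, ENNReal.ofReal (ε₀ ^ 3) ≤ ∫⁻ y in ball x (2 * r), ‖u t y‖ₑ ^ 3) →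
        (F.card : ℝ) ≤ C_E / (ε₀ ^ 3 * Real.sqrt (T - t)) := by
  obtain ⟨C, hC⟩ := hI
  obtain ⟨t₁, ht₁T, hsub⟩ := mem_nhdsLT_iff_exists_Ioo_subset.1 hC
  set C' : ℝ := max C 0 with hC'
  have hC'0 : 0 ≤ C' := le_max_right _ _
  set E₀ : ℝ := VectorCalculus.kineticEnergy (u 0) with hE₀
  have hE₀0 : 0 ≤ E₀ := by
    rw [hE₀, VectorCalculus.kineticEnergy]
    exact mul_nonneg (by norm_num) (integral_nonneg fun _ => by positivity)
  refine ⟨16 * C' * E₀, t₁, by positivity, ht₁T, fun ε₀ hε₀ t ht ht₁ r hr F hsep hconc => ?_⟩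
  have hTt : 0 < T - t := by linarith [ht.2]
  have hsq : 0 < Real.sqrt (T - t) := Real.sqrt_pos.2 hTt
  -- the sup bound on the slice
  have hbd : ∀ y, ‖u t y‖ ≤ C' / Real.sqrt (T - t) := fun y =>
    (hsub ⟨ht₁, ht.2⟩ y).trans (div_le_div_of_nonneg_right (le_max_left _ _) hsq.le)
  -- the energy bound on the slice
  have htI : t ∈ Icc 0 T := ⟨ht.1, ht.2.le⟩
  have hEn : ∫⁻ y, ‖u t y‖ₑ ^ 2 ≤ ENNReal.ofReal (2 * E₀) := hLH.eEnergy_le_datum hν.le htI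
  have hcard := card_le_of_norm_le (hLH.memLp t htI).aestronglyMeasurable (by positivity) hbd
    (by positivity) hEn hr hε₀ F hsep hconc
  refine hcard.trans (le_of_eq ?_)
  field_simp
  ring

/-- **Large swarms live only in the final window.** With `C_E, t₁` as in `card_le_typeI_energy_ceiling`: if at a time
`t ∈ [0,T)`, `t > t₁`, some S2 family at some scale `r` has at least `N ≥ 1` members, then
`T − t ≤ (C_E / (ε₀³ N))²`. [folklore] -/
theorem lifespan_le_of_swarm {ν T : ℝ}
    {u : ℝ → EuclideanSpace ℝ (Fin 3) → EuclideanSpace ℝ (Fin 3)} (hν : 0 < ν)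
    (hLH : IsLerayHopfOn T ν 0 (u 0) u) (hI : IsTypeIBlowup u T) :
    ∃ C_E t₁ : ℝ, 0 ≤ C_E ∧ t₁ < T ∧ ∀ ε₀ : ℝ, 0 < ε₀ → ∀ t ∈ Ico 0 T, t₁ < t → ∀ r : ℝ, 0 < r →
      ∀ N : ℕ, 1 ≤ N →
      (∃ F : Finset (EuclideanSpace ℝ (Fin 3)),
        (∀ x ∈ F, ∀ y ∈ F, x ≠ y → 4 * r ≤ dist x y) ∧
        (∀ x ∈ F, ENNReal.ofReal (ε₀ ^ 3) ≤ ∫⁻ y in ball x (2 * r), ‖u t y‖ₑ ^ 3) ∧ N ≤ F.card) →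
      T - t ≤ (C_E / (ε₀ ^ 3 * N)) ^ 2 := by
  obtain ⟨C_E, t₁, hCE, ht₁T, h⟩ := card_le_typeI_energy_ceiling hν hLH hI
  refine ⟨C_E, t₁, hCE, ht₁T, fun ε₀ hε₀ t ht ht₁ r hr N hN ⟨F, hsep, hconc, hNF⟩ => ?_⟩
  have hTt : 0 < T - t := by linarith [ht.2]
  have hsq : 0 < Real.sqrt (T - t) := Real.sqrt_pos.2 hTt
  have hNpos : (0 : ℝ) < N := by exact_mod_cast hN
  have hc := (Nat.cast_le.2 hNF).trans (h ε₀ hε₀ t ht ht₁ r hr F hsep hconc)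
  -- `N ≤ C_E/(ε₀³ √(T−t))` ⟹ `√(T−t) ≤ C_E/(ε₀³ N)`
  have h1 : Real.sqrt (T - t) ≤ C_E / (ε₀ ^ 3 * N) := by
    rw [le_div_iff₀ (by positivity)]
    rw [le_div_iff₀ (by positivity)] at hc
    linarith
  calc T - t = Real.sqrt (T - t) ^ 2 := (Real.sq_sqrt hTt.le).symm
    _ ≤ (C_E / (ε₀ ^ 3 * N)) ^ 2 := pow_le_pow_left₀ hsq.le h1 2

/-! ### By name, under stub 6 -/

/-- **Under stub 6 the Type-I energy ceiling holds at every first blow-up.** `TypeIliouvilleNoTypeII` (stmt-0056, the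
registered stub `stub_noTypeII` of line «sparse_sieve») gives `IsTypeIBlowup u T` for every maximal classical solution on
`[0,T)` that is Leray–Hopf from a rapidly decaying datum, hence the conclusion of `card_le_typeI_energy_ceiling` for it:
the families counted by the registered stub S2 (`stub_uniformSparseness`) have `card ≤ C_E/(ε₀³√(T−t))` at every scale.
Conditional on an OPEN statement; S2 itself asks for `O(1)`; no summit statement is proved. [folklore] -/
theorem typeIEnergyCeiling_of_stub_noTypeII
    (hS6 : Summit.NavierStokesRegularity.NavierStokesRegularity.Theses.TypeILiouville.TypeIliouvilleNoTypeII) :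
    ∀ (ν T : ℝ), 0 < ν → 0 < T →
      ∀ (u : ℝ → EuclideanSpace ℝ (Fin 3) → EuclideanSpace ℝ (Fin 3))
        (p : ℝ → EuclideanSpace ℝ (Fin 3) → ℝ),
      IsMaximalSmoothSolution ν 0 u p T → IsLerayHopfOn T ν 0 (u 0) u →
      HasRapidSpatialDecay (u 0) →
      ∃ C_E t₁ : ℝ, 0 ≤ C_E ∧ t₁ < T ∧ ∀ ε₀ : ℝ, 0 < ε₀ → ∀ t ∈ Ico 0 T, t₁ < t → ∀ r : ℝ, 0 < r →
        ∀ F : Finset (EuclideanSpace ℝ (Fin 3)),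
          (∀ x ∈ F, ∀ y ∈ F, x ≠ y → 4 * r ≤ dist x y) →
          (∀ x ∈ F, ENNReal.ofReal (ε₀ ^ 3) ≤ ∫⁻ y in ball x (2 * r), ‖u t y‖ₑ ^ 3) →
          (F.card : ℝ) ≤ C_E / (ε₀ ^ 3 * Real.sqrt (T - t)) :=
  fun ν T hν hT u p hmax hLH hdec =>
    card_le_typeI_energy_ceiling hν hLH (hS6 ν T hν hT u p hmax hLH hdec)

end Summit.NavierStokesRegularity.NavierStokesRegularity.Theorems.EnstrophyQuarterLaw.TypeIEnergyCeiling

end
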